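import Summits.QuantumFields.BalabanUV.Beta.GAN24.DressedSourceZeroModeWords
import Summits.QuantumFields.BalabanUV.Beta.GAN24.DressedSourceExchangeWords
import Summits.QuantumFields.BalabanUV.Beta.GAN24.WWordRespSummable
import Summits.QuantumFields.BalabanUV.Beta.SpineRootedW2
import Summits.QuantumFields.BalabanUV.Beta.MixedJetTablesPlug
import Summits.QuantumFields.BalabanUV.Beta.SecondOrderUnits

/-!
# `BalabanUV.Beta.GAN24.DressedSourceZeroModeLevelZero` — binder row G-an2-4 ∕ (CONV-C), W-slot CT-W, conservation law (C)∕(C)sym, the ASSEMBLY of this lineage's note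
# `HOME/b2b-balaban-gan24-formalise-leaf-04/g66/CSYM-LEVEL0-KERNEL-BLUEPRINT.md` §8: **THE ff ZERO MODE OF THE DRESSED LEVEL-0 SOURCE IS THE TWO `S^E ⊗ S^E` NUMBERS MINUS HALF THE
# CELL SUM OF THE TWO OUTER-SUMMED SECOND-RESPONSE WORDS** — pieces (I)+(II) of the level-0 (C_1) balance in p2's currency `zmode Lc b̃_0`, every axis pattern, any block-covariant
# multiplier vertex family, any jointly block-covariant mixed table, any border with no field–field block

NOT IN PRINT; OUR BOOKKEEPING ([folklore] one `rw` chain over this lineage's 21 `DressedSourceZeroModeWords.zmode_dressedSource_inl_inl_of_summable`, 30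
`DressedSourceExchangeWords.sum_box_tsum_direct_word_eq ∕ _swap_word_eq ∕ summable_right_word ∕ summable_left_word`, 32 `WWordRespSummable.sum_box_tsum_W_word_eq_half_outer_resp ∕
summable_twoFace_W2SymOfK_dressedStep_bond`, with the shapes BY NAME: an2's `SecondOrderResponse.vertexFamily_dM ∕ vertexFamily₂_W2SymOfK'`, `SpineRecursiveW.locStencil_SpureRecAt ∕
SpureRecAt_translate`, `AxialDressingRooted.decays_coDressKBmAt`, `EEWordReduced.shiftK_dressedStep`, 26 `VHWordsZeroBorder.unitS_translate_block`, an2's `vertexFamily_M1At ∕ M1At_translate ∕ locStencilFM_M2Of ∕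
M2Of_translate`, an1's `MixedJetTablesPlug.hmix_an1 ∕ hmixt_an1`; G-an2-4 formalisation swarm, leaf prover
`b2b-balaban-gan24-formalise-leaf-04`, gen 66).  HONEST FRAMING (cell contract, verbatim): «discharging `BetaPertH` makes Bałaban's UV stability UNCONDITIONAL — a real constructive-QFT
result; it is NOT the continuum limit and NOT the Clay problem.»  HONEST DEPENDENCY (verbatim): «continuum YM on T⁴ ⇐ BetaPertH ∧ nine spine estimates (0/9 proved); BetaPertH ⇐ (D1) ∧
(D4) ∧ CAP+tail; G-an2-4 gates asym, D1 and NE2/3/4.»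

WHAT ([folklore]; generic `d`, in-block root `ρ = toSite r`, `1 ≤ Lc`, LEVEL 0, period `Lc`, all units `s_f s_m`, colour constants `cE cVH cΛ`, scalars `c cB`; ANY multiplier vertex family `M`
(`VertexFamily` at a positive rate, block-covariant `M ρ′ (w + t) = shiftK (−Lc•t) (M ρ′ w)`), ANY mixed table `M₂` (`LocStencilFM` at a positive rate, jointly block-covariant), ANY border table
`B` without ff block; 0 `def`, 0 cited facts, 0 `def … : Prop`, 0 sorry), with `X̃♮_0 = unitK s_f s_m (coDressKBmAt ρ Lc (KInvStep Lc 0))`, `S♮_0 = unitS s_f s_m (SpureRecAt d Lc ρ cE cVH cΛ 0)`,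
`W̃ = W2SymOfK X̃♮_0 Lc S♮_0 M 0 M₂`, `σ₀ = (Lc^{d+2})⁻¹`, `K₁ = (Lc·s_m s_f·σ₀)·((s_f s_m)⁻¹ s_f⁻² cE)`, `E = [μ=ν][α=β] − [μ=β][α=ν]`, `E′ = [ν=μ][α=β] − [ν=β][α=μ]`,
`FF[K] = Σ'_{(y,w)} 𝟙f(y_α)𝟙f(w_β)·K y w (inl α)(inl β)`: `exists_level0_data` (one rate for all shapes) and **`zmode_dressedSource_level0_inl_inl`**:
`zmode Lc (c•mmRead Lc (K3OfK X̃♮_0 Lc S♮_0 M W̃) + cB•B) (μ,ν; inl α, inl β)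
 = c·(−(s_f s_m σ₀)²·Lc²)·( −K₁²s_f²·E·½Lc^{d−1}(Lc^{d+1} − Lc^{d−1}) + (−K₁²s_f²·E′·½Lc^{d−1}(Lc^{d+1} − Lc^{d−1}))
   − ½·Σ_{c∈box Lc}( Σ'_{u′} FF[dM (K2OfK X̃♮_0 Lc S♮_0 M ν c) Lc S♮_0 M μ u′] + Σ'_{u′} FF[dM (K2OfK X̃♮_0 Lc S♮_0 M μ c) Lc S♮_0 M ν u′] ) )`.
`locStencilFM_unitM₂`; **`zmode_dressedSource_level0_an1_inl_inl`** — the same at an1's tables `M = unitM s_f s_m (M1At d Lc ρ cΛ 0)`, `M₂ = unitM₂ s_f s_m (M2Of d Lc (mixFFAt ρ Lc) 0)` (p2's literal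
source at `j = 0`; only the ff-free border `B` generic).  The two remaining numbers are the OUTER-SUMMED SECOND-RESPONSE WORDS (blueprint §8 (L3c): expected `0` by the antisymmetry of
the Wilson edge current — NOT asserted here).  Asserts NO value of
Bałaban's tables beyond an3's ∕ an1's DEFINED ones; discharges NOTHING of (C)sym ∕ (Q-D) ∕ (Q-D-rate) ∕ «T2Shape» ∕ «T2Drift» ∕ (hW, hWall); NEVER «G-an2-4 closed» as (CONV-C); NOT D1, NOT
`BetaPertH`, NOT continuum, NOT Clay.  2026-08-23; no existing file touched.
-/

noncomputable section

open Finset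
open scoped BigOperators
open Literature.MathematicalPhysics.QuantumFieldTheory
open Literature.MathematicalPhysics.QuantumFieldTheory.Balaban1983to89
open Literature.MathematicalPhysics.QuantumFieldTheory.Balaban1983to89.Beta
open B12Sec2to5 (l1)
open ExpKernelCalculus (Site MKer comp shiftK Decays BiLoc VertexFamily VertexFamily₂)
open OneStepResolventKernel (Fib LocStencil decays_mono biLoc_mono)
open OneStepKernelFamily (KInvStep decays_KInvStep)
open BalabanStepJets (locStencil_mono)
open BalabanCompositeJets (LocStencil₂)
open SecondOrderResponse (dM K2OfK W2SymOfK LocStencilFM vertexFamily_dM vertexFamily₂_W2SymOfK' biLoc_smul)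
open BalabanStepW2 (M2Of locStencilFM_M2Of M2Of_translate)
open AveragingMixedJetTables (mixFFAt)
open BalabanStepW2 (K3OfK)
open BalabanStepJetsSucc (mmRead)
open AffineAveraging (box toSite)
open Summit.QuantumFields.BalabanUV.Beta.TameKernelCalculus (Loc Spr)
open Summit.QuantumFields.BalabanUV.Beta.AxialDressingRooted (coDressKBmAt decays_coDressKBmAt)
open Summit.QuantumFields.BalabanUV.Beta.HessKerDressedUnits (unitK unitS counitK counitK_apply decays_unitK locStencil_unitS biLoc_counitK)
open Summit.QuantumFields.BalabanUV.Beta.SecondOrderUnits (unitM unitM₂ unitM_apply)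
open Summit.QuantumFields.BalabanUV.Beta.SpineRooted (SpureRecAt locStencil_SpureRecAt SpureRecAt_translate M1At vertexFamily_M1At M1At_translate)
open Summit.QuantumFields.BalabanUV.Beta.MixedJetTablesPlug (hmix_an1 hmixt_an1)
open Summit.QuantumFields.BalabanUV.Beta.GAN24.BiStencilZeroMode (Tab zmode)
open Summit.QuantumFields.BalabanUV.Beta.GAN24.EEWordReduced (shiftK_dressedStep)
open Summit.QuantumFields.BalabanUV.Beta.GAN24.VHWordsZeroBorder (unitS_translate_block)
open Summit.QuantumFields.BalabanUV.Beta.GAN24.DressedSourceZeroModeWords (zmode_dressedSource_inl_inl_of_summable)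
open Summit.QuantumFields.BalabanUV.Beta.GAN24.DressedSourceExchangeWords (summable_right_word summable_left_word sum_box_tsum_direct_word_eq sum_box_tsum_swap_word_eq)
open Summit.QuantumFields.BalabanUV.Beta.GAN24.WWordRespSummable (sum_box_tsum_W_word_eq_half_outer_resp summable_twoFace_W2SymOfK_dressedStep_bond)

namespace Summit.QuantumFields.BalabanUV.Beta.GAN24.DressedSourceZeroModeLevelZero

variable {d : ℕ} {Lc : ℕ} [NeZero Lc] {r : Fin (d + 1) → ℕ}
  {M : Fin (d + 1) → Site (d + 1) → MKer (d + 1) (Fib d)} {CM δM : ℝ}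
  {M₂ : Fin (d + 1) → Site (d + 1) → Fin (d + 1) → Site (d + 1) → MKer (d + 1) (Fib d)} {C₂ δ₂ : ℝ}

/-- [folklore] **ONE RATE FOR ALL THE LEVEL-0 SHAPES**: the dressed kernel decays, `S♮_0` is a `LocStencil`, `M` a `VertexFamily`, and the background derivative `dM X̃♮_0 Lc S♮_0 M`
is a `VertexFamily`, all at one positive rate (an2's `locStencil_SpureRecAt` + `vertexFamily_dM`). -/
theorem exists_level0_data (hLc : 1 ≤ Lc) (hr : r ∈ box (d + 1) Lc) (sf sm cE cVH cΛ : ℝ) (hM : VertexFamily M Lc CM δM) (hδM : 0 < δM) :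
    ∃ m CX Cs Cv : ℝ, 0 < m ∧ Decays (unitK sf sm (coDressKBmAt (toSite r) Lc (KInvStep (d := d) Lc 0))) CX m ∧
      LocStencil (unitS sf sm (SpureRecAt d Lc (toSite r) cE cVH cΛ 0)) Cs m ∧ VertexFamily M Lc CM m ∧
      VertexFamily (dM (unitK sf sm (coDressKBmAt (toSite r) Lc (KInvStep (d := d) Lc 0))) Lc (unitS sf sm (SpureRecAt d Lc (toSite r) cE cVH cΛ 0)) M) Lc Cv m := by
  obtain ⟨δK, CK, hδK, hCK, hXd⟩ := decays_coDressKBmAt hLc hr (decays_KInvStep (d := d) (Lc := Lc) 0)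
  have hXu := decays_unitK (sf := sf) (sm := sm) hXd
  have hCX : 0 ≤ max |sf| |sm| * CK * max |sf| |sm| := by positivity
  obtain ⟨Cs₀, δs, hδs, hS₀⟩ := locStencil_SpureRecAt hLc hr cE cVH cΛ 0
  have hS := locStencil_unitS (sf := sf) (sm := sm) hS₀
  have hCs : 0 ≤ |(sf * sm)⁻¹| * (max |sf⁻¹| |sm⁻¹| * Cs₀ * max |sf⁻¹| |sm⁻¹|) := (hS 0 0).nonneg (Sum.inl 0)
  have hCM : 0 ≤ CM := (hM 0 0).nonneg (Sum.inl 0)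
  set m₁ : ℝ := min (min δK δs) δM with hm₁
  have hm₁0 : 0 < m₁ := lt_min (lt_min hδK hδs) hδM
  have hX1 : Decays (unitK sf sm (coDressKBmAt (toSite r) Lc (KInvStep (d := d) Lc 0))) (max |sf| |sm| * CK * max |sf| |sm|) m₁ :=
    decays_mono hXu hCX le_rfl ((min_le_left _ _).trans (min_le_left _ _))
  have hS1 := locStencil_mono hS hCs ((min_le_left _ _).trans (min_le_right _ _) : m₁ ≤ δs)
  have hM1 : VertexFamily M Lc CM m₁ := fun ρ' w => biLoc_mono (hM ρ' w) hCM (min_le_right _ _)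
  have hV := vertexFamily_dM (N := Lc) hX1 hCX hS1 hM1 hm₁0 le_rfl
  refine ⟨m₁ / 2, _, _, _, half_pos hm₁0, decays_mono hX1 hCX le_rfl (by linarith), locStencil_mono hS1 hCs (by linarith),
    fun ρ' w => biLoc_mono (hM1 ρ' w) hCM (by linarith), hV⟩

/-- [folklore] **THE ff ZERO MODE OF THE DRESSED LEVEL-0 SOURCE = THE TWO `S^E ⊗ S^E` NUMBERS − ½·(THE TWO OUTER-SUMMED SECOND-RESPONSE WORDS)** (statement in the header; p2's
`zmode_succ_eq_fourFace` at `j = 0` carries exactly the left side with `c = cE₂·Lc^{2(d+1)}`, `M = unitM … (M1At …)`, `M₂ = unitM₂ … (M2Of …)`, `B = vh₂S`). -/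
theorem zmode_dressedSource_level0_inl_inl (hLc : 1 ≤ Lc) (hr : r ∈ box (d + 1) Lc) (sf sm cE cVH cΛ : ℝ)
    (hM : VertexFamily M Lc CM δM) (hδM : 0 < δM) (hMcov : ∀ (ρ' : Fin (d + 1)) (w t : Site (d + 1)), M ρ' (w + t) = shiftK (-((Lc : ℤ) • t)) (M ρ' w))
    (hM₂ : LocStencilFM Lc M₂ C₂ δ₂) (hδ₂ : 0 < δ₂)
    (hM₂t : ∀ (κ : Fin (d + 1)) (u : Site (d + 1)) (ρ' : Fin (d + 1)) (w t : Site (d + 1)),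
      M₂ κ (u + (Lc : ℤ) • t) ρ' (w + t) = shiftK (-((Lc : ℤ) • t)) (M₂ κ u ρ' w))
    {B : Tab d} (hBff : ∀ κ u κ' u' x z (α β : Fin (d + 1)), B κ u κ' u' x z (Sum.inl α) (Sum.inl β) = 0) (c cB : ℝ) (μ ν α β : Fin (d + 1)) :
    zmode Lc (fun κ u κ' u' => c • mmRead Lc (K3OfK (unitK sf sm (coDressKBmAt (toSite r) Lc (KInvStep (d := d) Lc 0))) Lc
        (unitS sf sm (SpureRecAt d Lc (toSite r) cE cVH cΛ 0)) M
        (W2SymOfK (unitK sf sm (coDressKBmAt (toSite r) Lc (KInvStep (d := d) Lc 0))) Lc (unitS sf sm (SpureRecAt d Lc (toSite r) cE cVH cΛ 0)) M 0 M₂) κ u κ' u')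
        + cB • B κ u κ' u') μ ν (Sum.inl α) (Sum.inl β) =
      c * (-((sf * sm * ((((Lc ^ (0 + 1) : ℕ) : ℝ)) ^ (d + 1 + 1))⁻¹) * (sf * sm * ((((Lc ^ (0 + 1) : ℕ) : ℝ)) ^ (d + 1 + 1))⁻¹)) * ((Lc : ℝ) * (Lc : ℝ))) *
        (-(((((Lc : ℝ) * (sm * sf)) * ((((Lc ^ (0 + 1) : ℕ) : ℝ)) ^ (d + 1 + 1))⁻¹) * ((sf * sm)⁻¹ * (sf⁻¹ * sf⁻¹) * cE))) ^ 2 * (sf * sf) *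
            (((if μ = ν ∧ α = β then (1 : ℝ) else 0) - (if μ = β ∧ α = ν then (1 : ℝ) else 0)) * ((1 / 2 : ℝ) * (Lc : ℝ) ^ (d - 1) * ((Lc : ℝ) ^ (d + 1) - (Lc : ℝ) ^ (d - 1)))) +
          -(((((Lc : ℝ) * (sm * sf)) * ((((Lc ^ (0 + 1) : ℕ) : ℝ)) ^ (d + 1 + 1))⁻¹) * ((sf * sm)⁻¹ * (sf⁻¹ * sf⁻¹) * cE))) ^ 2 * (sf * sf) *
            (((if ν = μ ∧ α = β then (1 : ℝ) else 0) - (if ν = β ∧ α = μ then (1 : ℝ) else 0)) * ((1 / 2 : ℝ) * (Lc : ℝ) ^ (d - 1) * ((Lc : ℝ) ^ (d + 1) - (Lc : ℝ) ^ (d - 1)))) -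
          (1 / 2 : ℝ) * ∑ c' ∈ box (d + 1) Lc,
            ((∑' u' : Site (d + 1), ∑' yw : Site (d + 1) × Site (d + 1),
                (if yw.1 α % (Lc : ℤ) = (Lc : ℤ) - 1 then (1 : ℝ) else 0) * (if yw.2 β % (Lc : ℤ) = (Lc : ℤ) - 1 then (1 : ℝ) else 0) *
                  dM (K2OfK (unitK sf sm (coDressKBmAt (toSite r) Lc (KInvStep (d := d) Lc 0))) Lc (unitS sf sm (SpureRecAt d Lc (toSite r) cE cVH cΛ 0)) M ν (toSite c')) Lc
                    (unitS sf sm (SpureRecAt d Lc (toSite r) cE cVH cΛ 0)) M μ u' yw.1 yw.2 (Sum.inl α) (Sum.inl β))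
              + ∑' u' : Site (d + 1), ∑' yw : Site (d + 1) × Site (d + 1),
                (if yw.1 α % (Lc : ℤ) = (Lc : ℤ) - 1 then (1 : ℝ) else 0) * (if yw.2 β % (Lc : ℤ) = (Lc : ℤ) - 1 then (1 : ℝ) else 0) *
                  dM (K2OfK (unitK sf sm (coDressKBmAt (toSite r) Lc (KInvStep (d := d) Lc 0))) Lc (unitS sf sm (SpureRecAt d Lc (toSite r) cE cVH cΛ 0)) M μ (toSite c')) Lc
                    (unitS sf sm (SpureRecAt d Lc (toSite r) cE cVH cΛ 0)) M ν u' yw.1 yw.2 (Sum.inl α) (Sum.inl β))) := by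
  classical
  obtain ⟨m, CX, Cs, Cv, hm, hXd, hS, hM', hV⟩ := exists_level0_data hLc hr sf sm cE cVH cΛ hM hδM
  have hCX : 0 ≤ CX := hXd.nonneg (Sum.inl 0)
  have hX : Spr (unitK sf sm (coDressKBmAt (toSite r) Lc (KInvStep (d := d) Lc 0))) := ⟨_, _, hm, hXd⟩
  have hb : ∀ (κ : Fin (d + 1)) (y : Site (d + 1)),
      Loc (dM (unitK sf sm (coDressKBmAt (toSite r) Lc (KInvStep (d := d) Lc 0))) Lc (unitS sf sm (SpureRecAt d Lc (toSite r) cE cVH cΛ 0)) M κ y) :=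
    fun κ y => ⟨_, _, _, _, hm, hV κ y⟩
  have hz : LocStencil₂ (0 : Fin (d + 1) → (Fin (d + 1) → ℤ) → Fin (d + 1) → (Fin (d + 1) → ℤ) → MKer (d + 1) (Fib d)) 0 1 := by
    intro κ u κ' u' x z a b; simp
  obtain ⟨Cw, δw, hδw, hWF⟩ := vertexFamily₂_W2SymOfK' (N := Lc) ⟨m, CX, hm, hCX, hXd⟩ hS hm hM' hm hz one_pos hM₂ hδ₂
  have hW : ∀ (κ : Fin (d + 1)) (y : Site (d + 1)) (κ' : Fin (d + 1)) (y' : Site (d + 1)),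
      Loc (W2SymOfK (unitK sf sm (coDressKBmAt (toSite r) Lc (KInvStep (d := d) Lc 0))) Lc (unitS sf sm (SpureRecAt d Lc (toSite r) cE cVH cΛ 0)) M 0 M₂ κ y κ' y') :=
    fun κ y κ' y' => ⟨_, _, _, _, hδw, hWF κ y κ' y'⟩
  have hρα : ∀ y : Site (d + 1), |(if y α % (Lc : ℤ) = (Lc : ℤ) - 1 then (1 : ℝ) else 0)| ≤ 1 := fun y => by split_ifs <;> simp
  have hρβ : ∀ w : Site (d + 1), |(if w β % (Lc : ℤ) = (Lc : ℤ) - 1 then (1 : ℝ) else 0)| ≤ 1 := fun w => by split_ifs <;> simp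
  have hSt : ∀ (κ : Fin (d + 1)) (u t : Site (d + 1)), unitS sf sm (SpureRecAt d Lc (toSite r) cE cVH cΛ 0) κ (u + (Lc : ℤ) • t) =
      shiftK (-((Lc : ℤ) • t)) (unitS sf sm (SpureRecAt d Lc (toSite r) cE cVH cΛ 0) κ u) :=
    fun κ u t => unitS_translate_block (Lc := Lc) sf sm (fun κ u t => SpureRecAt_translate (toSite r) hLc cE cVH cΛ 0 κ u t) κ u t
  have h1 := fun u : Site (d + 1) => summable_right_word (Lc := Lc) (hb μ u) hX hV hm hρα hρβ ν (Sum.inl α) (Sum.inl β)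
  have h2 := fun u : Site (d + 1) => summable_left_word (Lc := Lc) (hb μ u) hX hV hm hρα hρβ ν (Sum.inl α) (Sum.inl β)
  have h3 := fun u : Site (d + 1) => summable_twoFace_W2SymOfK_dressedStep_bond hLc hr sf sm 0 hS hm hM' hm hM₂ hδ₂ hM₂t hρα hρβ
    (fun y s => ExchangeSlotResum.face_weight_periodic Lc α y s) (fun w s => ExchangeSlotResum.face_weight_periodic Lc β w s) μ u ν (Sum.inl α) (Sum.inl β)
  rw [zmode_dressedSource_inl_inl_of_summable hLc hr sf sm 0 c cB hb hW hBff Lc μ ν α β h1 h2 h3,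
    sum_box_tsum_direct_word_eq hLc hr sf sm cE cVH cΛ hM hδM hMcov, sum_box_tsum_swap_word_eq hLc hr sf sm cE cVH cΛ hM hδM hMcov,
    sum_box_tsum_W_word_eq_half_outer_resp hLc hr sf sm 0 hS hm hM' hm hM₂ hδ₂ hM₂t hSt hMcov Lc μ ν α β]


/-! ## The instance at an1's tables (p2's literal source at `j = 0`) -/

omit [NeZero Lc] in
/-- [folklore] Units transport of a `LocStencilFM` mixed table through `unitM₂` (`biLoc_counitK`, `biLoc_smul` twice). -/
theorem locStencilFM_unitM₂ (sf sm : ℝ) {C δ : ℝ} (h : LocStencilFM Lc M₂ C δ) :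
    LocStencilFM Lc (unitM₂ sf sm M₂) (|(sf * sm)⁻¹| * (|(sm * sm)⁻¹| * (max |sf⁻¹| |sm⁻¹| * C * max |sf⁻¹| |sm⁻¹|))) δ := by
  intro κ u ρ' w
  have h1 := biLoc_smul ((sf * sm)⁻¹) (biLoc_smul ((sm * sm)⁻¹) (biLoc_counitK (sf := sf) (sm := sm) (h κ u ρ' w)))
  have e : |(sf * sm)⁻¹| * (|(sm * sm)⁻¹| * (max |sf⁻¹| |sm⁻¹| * (C * Real.exp (-δ * l1 (u - (Lc : ℤ) • w))) * max |sf⁻¹| |sm⁻¹|))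
      = |(sf * sm)⁻¹| * (|(sm * sm)⁻¹| * (max |sf⁻¹| |sm⁻¹| * C * max |sf⁻¹| |sm⁻¹|)) * Real.exp (-δ * l1 (u - (Lc : ℤ) • w)) := by ring
  rw [e] at h1
  exact h1

/-- [folklore] **THE SAME AT an1's TABLES** — p2's literal level-0 source: `M = unitM s_f s_m (M1At d Lc ρ cΛ 0)` (an2's `vertexFamily_M1At` ∕ `M1At_translate` through `unitM`) and
`M₂ = unitM₂ s_f s_m (M2Of d Lc (mixFFAt ρ Lc) 0)` (an1's `hmix_an1` ∕ `hmixt_an1` through `locStencilFM_M2Of` ∕ `M2Of_translate` and `unitM₂`); every hypothesis of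
`zmode_dressedSource_level0_inl_inl` discharged BY NAME, only the ff-free border `B` (p2's `vh₂S`, `hBff`) stays generic. -/
theorem zmode_dressedSource_level0_an1_inl_inl (hLc : 1 ≤ Lc) (hr : r ∈ box (d + 1) Lc) (sf sm cE cVH cΛ : ℝ)
    {B : Tab d} (hBff : ∀ κ u κ' u' x z (α β : Fin (d + 1)), B κ u κ' u' x z (Sum.inl α) (Sum.inl β) = 0) (c cB : ℝ) (μ ν α β : Fin (d + 1)) :
    zmode Lc (fun κ u κ' u' => c • mmRead Lc (K3OfK (unitK sf sm (coDressKBmAt (toSite r) Lc (KInvStep (d := d) Lc 0))) Lc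
        (unitS sf sm (SpureRecAt d Lc (toSite r) cE cVH cΛ 0)) (unitM sf sm (M1At d Lc (toSite r) cΛ 0))
        (W2SymOfK (unitK sf sm (coDressKBmAt (toSite r) Lc (KInvStep (d := d) Lc 0))) Lc (unitS sf sm (SpureRecAt d Lc (toSite r) cE cVH cΛ 0))
          (unitM sf sm (M1At d Lc (toSite r) cΛ 0)) 0 (unitM₂ sf sm (M2Of d Lc (mixFFAt (toSite r) Lc) 0))) κ u κ' u')
        + cB • B κ u κ' u') μ ν (Sum.inl α) (Sum.inl β) =
      c * (-((sf * sm * ((((Lc ^ (0 + 1) : ℕ) : ℝ)) ^ (d + 1 + 1))⁻¹) * (sf * sm * ((((Lc ^ (0 + 1) : ℕ) : ℝ)) ^ (d + 1 + 1))⁻¹)) * ((Lc : ℝ) * (Lc : ℝ))) *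
        (-(((((Lc : ℝ) * (sm * sf)) * ((((Lc ^ (0 + 1) : ℕ) : ℝ)) ^ (d + 1 + 1))⁻¹) * ((sf * sm)⁻¹ * (sf⁻¹ * sf⁻¹) * cE))) ^ 2 * (sf * sf) *
            (((if μ = ν ∧ α = β then (1 : ℝ) else 0) - (if μ = β ∧ α = ν then (1 : ℝ) else 0)) * ((1 / 2 : ℝ) * (Lc : ℝ) ^ (d - 1) * ((Lc : ℝ) ^ (d + 1) - (Lc : ℝ) ^ (d - 1)))) +
          -(((((Lc : ℝ) * (sm * sf)) * ((((Lc ^ (0 + 1) : ℕ) : ℝ)) ^ (d + 1 + 1))⁻¹) * ((sf * sm)⁻¹ * (sf⁻¹ * sf⁻¹) * cE))) ^ 2 * (sf * sf) *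
            (((if ν = μ ∧ α = β then (1 : ℝ) else 0) - (if ν = β ∧ α = μ then (1 : ℝ) else 0)) * ((1 / 2 : ℝ) * (Lc : ℝ) ^ (d - 1) * ((Lc : ℝ) ^ (d + 1) - (Lc : ℝ) ^ (d - 1)))) -
          (1 / 2 : ℝ) * ∑ c' ∈ box (d + 1) Lc,
            ((∑' u' : Site (d + 1), ∑' yw : Site (d + 1) × Site (d + 1),
                (if yw.1 α % (Lc : ℤ) = (Lc : ℤ) - 1 then (1 : ℝ) else 0) * (if yw.2 β % (Lc : ℤ) = (Lc : ℤ) - 1 then (1 : ℝ) else 0) *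
                  dM (K2OfK (unitK sf sm (coDressKBmAt (toSite r) Lc (KInvStep (d := d) Lc 0))) Lc (unitS sf sm (SpureRecAt d Lc (toSite r) cE cVH cΛ 0))
                    (unitM sf sm (M1At d Lc (toSite r) cΛ 0)) ν (toSite c')) Lc
                    (unitS sf sm (SpureRecAt d Lc (toSite r) cE cVH cΛ 0)) (unitM sf sm (M1At d Lc (toSite r) cΛ 0)) μ u' yw.1 yw.2 (Sum.inl α) (Sum.inl β))
              + ∑' u' : Site (d + 1), ∑' yw : Site (d + 1) × Site (d + 1),
                (if yw.1 α % (Lc : ℤ) = (Lc : ℤ) - 1 then (1 : ℝ) else 0) * (if yw.2 β % (Lc : ℤ) = (Lc : ℤ) - 1 then (1 : ℝ) else 0) *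
                  dM (K2OfK (unitK sf sm (coDressKBmAt (toSite r) Lc (KInvStep (d := d) Lc 0))) Lc (unitS sf sm (SpureRecAt d Lc (toSite r) cE cVH cΛ 0))
                    (unitM sf sm (M1At d Lc (toSite r) cΛ 0)) μ (toSite c')) Lc
                    (unitS sf sm (SpureRecAt d Lc (toSite r) cE cVH cΛ 0)) (unitM sf sm (M1At d Lc (toSite r) cΛ 0)) ν u' yw.1 yw.2 (Sum.inl α) (Sum.inl β))) := by
  obtain ⟨C₂, δ₂, hδ₂, hmix⟩ := hmix_an1 hLc hr
  have hM : VertexFamily (unitM sf sm (M1At d Lc (toSite r) cΛ 0)) Lc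
      (|(sm * sm)⁻¹| * (max |sf⁻¹| |sm⁻¹| * (|cΛ * BalabanStepW2.wM1 d Lc 0| * (2 * (AveragingHessianKernels.ell (d + 1) Lc : ℝ) ^ 2 * Real.exp (4 * ((d : ℝ) + 1) * Lc * 1))) *
        max |sf⁻¹| |sm⁻¹|)) 1 :=
    fun ρ' w => biLoc_smul ((sm * sm)⁻¹) (biLoc_counitK (vertexFamily_M1At hLc hr cΛ 0 zero_le_one ρ' w))
  have hMcov : ∀ (ρ' : Fin (d + 1)) (w t : Site (d + 1)),
      unitM sf sm (M1At d Lc (toSite r) cΛ 0) ρ' (w + t) = shiftK (-((Lc : ℤ) • t)) (unitM sf sm (M1At d Lc (toSite r) cΛ 0) ρ' w) := by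
    intro ρ' w t
    funext x z a b
    simp only [unitM_apply, shiftK, M1At_translate (Lc := Lc) (toSite r) cΛ 0 ρ' w t]
  have hM₂ := locStencilFM_unitM₂ (Lc := Lc) (M₂ := M2Of d Lc (mixFFAt (toSite r) Lc) 0) sf sm (locStencilFM_M2Of hmix 0)
  have hM₂t : ∀ (κ : Fin (d + 1)) (u : Site (d + 1)) (ρ' : Fin (d + 1)) (w t : Site (d + 1)),
      unitM₂ sf sm (M2Of d Lc (mixFFAt (toSite r) Lc) 0) κ (u + (Lc : ℤ) • t) ρ' (w + t) =
        shiftK (-((Lc : ℤ) • t)) (unitM₂ sf sm (M2Of d Lc (mixFFAt (toSite r) Lc) 0) κ u ρ' w) := by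
    intro κ u ρ' w t
    funext x z a b
    simp only [unitM₂, unitM, Pi.smul_apply, smul_eq_mul, counitK_apply, shiftK, M2Of_translate (hmixt_an1 (toSite r)) 0 κ u ρ' w t]
  exact zmode_dressedSource_level0_inl_inl hLc hr sf sm cE cVH cΛ hM one_pos hMcov hM₂ hδ₂ hM₂t hBff c cB μ ν α β

end Summit.QuantumFields.BalabanUV.Beta.GAN24.DressedSourceZeroModeLevelZero

end
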